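import Literature.Analysis.FluidPDE.CKNPressureHessianSlice
import Literature.Analysis.FluidPDE.CKNPressureDualityFar
import Literature.Analysis.FluidPDE.CKNMorreyLocalEnergy
import Literature.Analysis.FluidPDE.WeakGradientSlicing
import Literature.Analysis.FunctionSpaces.MixedNormTestDuality
import HarnessLib

/-!
# The local pressure against the velocity on `(t-ρ²,t+ρ²) × B(x,3ρ/4)`: dual splitting
(towards (13.28)–(13.29) of Lemarié-Rieusset 2016, Lemma 13.3)

Analysis/FluidPDE support file (all results proved) in the decomposition of the named fact
`Literature.Analysis.FluidPDE.LemarieRieusset2016.step1_pressureTerm`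
(`CKNMorreyLocalEnergySteps.lean`; Lemarié-Rieusset 2016, §13.9 Step 1, pp. 468–469: the third
term `∬_{(t-ρ²,t+ρ²)×B(x,3ρ/4)} r⁻¹ |p| |u|` of the local energy inequality).

In print (p. 468–469) the localised pressure is split through the Newtonian kernel,
`ζp = p_{ρ,x} + q_{ρ,x}` on `(t-ρ², t+ρ²) × B(x, 3ρ/4)`, with the *harmonic part*
`|p_{ρ,x}(s,y)| ≤ C ρ⁻³ ∫_{B(x,ρ)} |p(s,z)| dz` (the data `(∂ⱼζ)p`, `(Δζ)p` sit at distance `≥ ρ/16`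
from `B(x,3ρ/4)`, where the kernels are bounded) and the *Calderón–Zygmund part*
`‖q_{ρ,x}(s,·)‖_{L^{3/2}} ≤ C ‖u(s)‖_{L²(B(x,ρ))} ‖∇ ⊗ u(s)‖_{L²(B(x,ρ))}`. Here, as in the tree's
treatment of (13.20) (`CKNPressureDuality`), the kernel is moved onto the test function: for
`Ψ ∈ C_c^∞(I × B(x,3ρ/4))`, `I = (t-ρ², t+ρ²)`, the pressure equation tested with the
slicewise truncated potential `Θ = N_{ρ/8,ρ/4}[Ψ(s,·)] ∈ C_c^∞(Q_ρ(t,x))` gives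
`∫∫ p Ψ = ∫∫ p ΛΨ - ∫∫ D²Θ(u,u)` (`integral_pressure_mul_test_eq`), and

* the harmonic part: `|ΛΨ(s,y)| ≤ ‖λ_{ρ/8,ρ/4}‖_∞ ‖Ψ(s,·)‖_{L¹}` with `‖λ_{ρ/8,ρ/4}‖_∞ ≤ L₁ (ρ/4)⁻³`
  (scaling, `exists_newtonFarLaplacian_half_bound`), and `ΛΨ(s,·)` supported in `B(x,ρ)`, so
  `|∫∫ p ΛΨ| ≤ L₁(ρ/4)⁻³ ∫_I (∫_{B(x,ρ)} |p(s)|) ‖Ψ(s,·)‖_{L¹} ds`;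
* the Calderón–Zygmund part, slice by slice:
  `|∫ D²Θ(s)(u,u)| ≤ K a(s)^{1/2} e(s)^{1/2} ‖Ψ(s,·)‖_{L³}` for a.e. `s`
  (`exists_hessian_slice_bound`: Stein's `L³` bound and the Poincaré–Sobolev inequality on
  `B(x,ρ)`), `a(s) = ∫_{B(x,ρ)} |u(s)|²`, `e(s) = ∫_{B(x,ρ)} |∇ ⊗ u(s)|²`.

Hence the **dual bound** (`enorm_setIntegral_pressure_mul_test_le`)

  `|∫∫ p Ψ| ≤ ∫_I (L₁(ρ/4)⁻³ π(s) ‖Ψ(s)‖_{L¹} + K a(s)^{1/2} e(s)^{1/2} ‖Ψ(s)‖_{L³}) ds`,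
  `π(s) = ∫_{B(x,ρ)} |p(s)|`,

for every test function `Ψ` on `I × B(x, 3ρ/4)`, and, by the mixed-norm density lemma
(`FunctionSpaces.lintegral_enorm_mul_le_mixed_of_forall_test`), the **bilinear bound**
(`lintegral_pressure_velocity_le_mixed`)

  `∬_{I×B(x,3ρ/4)} |p| |u| ≤ ∫_I (L₁(ρ/4)⁻³ π(s) ‖u(s)‖_{L¹(B(x,3ρ/4))}
      + K a(s)^{1/2} e(s)^{1/2} ‖u(s)‖_{L³(B(x,3ρ/4))}) ds`,

which is the printed pair of estimates before the Hölder-in-time bookkeeping of (13.28)–(13.29)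
(done in `CKNMorreyPressureTerm`).

## References

* P. G. Lemarié-Rieusset, *The Navier–Stokes Problem in the 21st Century*, CRC Press (2016),
  §13.9 Step 1, pp. 468–469, (13.28)–(13.29). [LemarieRieusset2016]
-/

noncomputable section

open MeasureTheory Set Function Filter Topology TopologicalSpace Metric InnerProductSpace
open scoped ENNReal NNReal RealInnerProductSpace

namespace Literature.Analysis.FluidPDE

open LemarieRieusset2016

/-! ### The far-field kernel at scale `r`: `|λ_{r/2,r}| ≤ L₁ r⁻³` -/

/-- **Scale-invariant bound for the smoothing kernel**: there is `L₁` with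
`|λ_{r/2,r}(y)| ≤ L₁ r⁻³` for all `r > 0` and all `y` (`λ_{r/2,r}(y) = r⁻³ λ_{1/2,1}(y/r)`,
`newtonFarLaplacian_scale`, and `λ_{1/2,1}` is continuous with compact support). This is the
printed "`|∂ⱼG|, |G| ≤ C ρ⁻², C ρ⁻¹` at distance `≥ ρ/16`" behind
`|p_{ρ,x}(s,y)| ≤ C ρ⁻³ ∫_{B(x,ρ)} |p(s,z)| dz` (Lemarié-Rieusset 2016, p. 469). [folklore] -/
theorem exists_newtonFarLaplacian_half_bound :
    ∃ L₁ : ℝ≥0, ∀ r : ℝ, 0 < r → ∀ y : EuclideanSpace ℝ (Fin 3),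
      ‖newtonFarLaplacian (r / 2) r y‖ ≤ L₁ * r⁻¹ ^ 3 := by
  have h₀ : (0 : ℝ) < 1 / 2 := by norm_num
  have h₁ : (1 / 2 : ℝ) < 1 := by norm_num
  obtain ⟨L₀, hL₀⟩ := (continuous_newtonFarLaplacian h₀ h₁).bounded_above_of_compact_support
    (hasCompactSupport_newtonFarLaplacian h₀.le h₁)
  refine ⟨L₀.toNNReal, fun r hr y => ?_⟩
  have hscale := newtonFarLaplacian_scale hr (1 / 2) 1 y
  rw [mul_one, mul_one_div] at hscale
  rw [hscale, norm_mul, Real.norm_eq_abs, abs_of_nonneg (by positivity), mul_comm]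
  exact mul_le_mul_of_nonneg_right ((hL₀ _).trans (Real.le_coe_toNNReal L₀)) (by positivity)

/-! ### Supports of slices -/

/-- The time slices of a compactly supported space–time function supported in `I × B` are
supported in `B`. [folklore] -/
theorem tsupport_slice_subset_of_tsupport_subset_prod {X : Type*} [TopologicalSpace X]
    [T2Space X] {θ : ℝ → X → ℝ} (hc : HasCompactSupport (uncurry θ)) {I : Set ℝ} {B : Set X}
    (h : tsupport (uncurry θ) ⊆ I ×ˢ B) (s : ℝ) : tsupport (θ s) ⊆ B := by
  have h1 : tsupport (θ s) ⊆ Prod.snd '' tsupport (uncurry θ) := by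
    refine closure_minimal (fun y hy => ⟨(s, y), subset_tsupport _ hy, rfl⟩)
      (hc.image continuous_snd).isClosed
  refine h1.trans ?_
  rintro _ ⟨⟨s', y⟩, hsy, rfl⟩
  exact (h hsy).2

/-! ### The dual bound for one test function -/

variable {Ω : Opens (ℝ × EuclideanSpace ℝ (Fin 3))} {ν : ℝ}
  {f u : ℝ → EuclideanSpace ℝ (Fin 3) → EuclideanSpace ℝ (Fin 3)}
  {p : ℝ → EuclideanSpace ℝ (Fin 3) → ℝ}
  {G : ℝ → EuclideanSpace ℝ (Fin 3) → EuclideanSpace ℝ (Fin 3) →L[ℝ] EuclideanSpace ℝ (Fin 3)}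
  {z : ℝ × EuclideanSpace ℝ (Fin 3)} {ρ : ℝ}

/-- **The local pressure tested against `Ψ ∈ C_c^∞((t-ρ²,t+ρ²) × B(x,3ρ/4))`: the splitting
(13.28)–(13.29) in dual form** (Lemarié-Rieusset 2016, §13.9 pp. 468–469). Let `(u, p)` be a
distributional Navier–Stokes solution on `Ω` with force `f ∈ L¹_loc(Ω)`, `div f = 0`, let
`Q_ρ(t,x) ⊆ Ω` (`ρ > 0`), let `G` be a weak spatial gradient of `u` on `Q_ρ(t,x)` with
`U_ρ(t,x), V_ρ(t,x) < ∞`, let `L₁` bound the smoothing kernels (`|λ_{r/2,r}| ≤ L₁ r⁻³`) and `K` be a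
constant of `exists_hessian_slice_bound`. Then for every smooth compactly supported `Ψ` with
`tsupport Ψ ⊆ I × B(x, 3ρ/4)`, `I = (t-ρ², t+ρ²)`,
`‖∫∫ p Ψ‖ ≤ ∫_I (L₁(ρ/4)⁻³ π(s) ‖Ψ(s,·)‖_{L¹} + K a(s)^{1/2} e(s)^{1/2} ‖Ψ(s,·)‖_{L³}) ds`
with `π(s) = ∫_{B(x,ρ)} |p(s)|`, `a(s) = ∫_{B(x,ρ)} |u(s)|²`, `e(s) = ∫_{B(x,ρ)} |∇ ⊗ u(s)|²`: the
pressure equation tested with `Θ = N_{ρ/8,ρ/4}[Ψ(s,·)]`, the harmonic part `∫∫ p ΛΨ` bounded by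
the kernel bound, the Calderón–Zygmund part `∫∫ D²Θ(u,u)` slice-wise by
`exists_hessian_slice_bound`. [cite: LemarieRieusset2016, §13.9 (13.28)–(13.29) p. 469] -/
theorem enorm_setIntegral_pressure_mul_test_le
    (hns : IsDistributionalNSSolutionOn Ω ν f u p)
    (hfi : LocallyIntegrableOn (uncurry f) (Ω : Set (ℝ × EuclideanSpace ℝ (Fin 3))) volume)
    (hdivf : ∀ φ : ℝ → EuclideanSpace ℝ (Fin 3) → ℝ, IsSpaceTimeTestOn Ω φ →
      ∫ t, ∫ x, ⟪f t x, gradient (φ t) x⟫ = 0)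
    (hρ : 0 < ρ)
    (hQΩ : parabolicCylinderCentered ρ z ⊆ (Ω : Set (ℝ × EuclideanSpace ℝ (Fin 3))))
    (hG : HasWeakSpatialGradientOn (parabolicCylinderCenteredOpens ρ z) u G)
    (hU : energyU u ρ z ≠ ∞) (hV : gradV G ρ z ≠ ∞)
    {L₁ : ℝ≥0} (hL₁ : ∀ r : ℝ, 0 < r → ∀ y : EuclideanSpace ℝ (Fin 3),
      ‖newtonFarLaplacian (r / 2) r y‖ ≤ L₁ * r⁻¹ ^ 3)
    {K : ℝ≥0} (hK : ∀ (x₀ : EuclideanSpace ℝ (Fin 3)) (ρ : ℝ), 0 < ρ →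
      ∀ (w : EuclideanSpace ℝ (Fin 3) → EuclideanSpace ℝ (Fin 3))
      (Gw : EuclideanSpace ℝ (Fin 3) → EuclideanSpace ℝ (Fin 3) →L[ℝ] EuclideanSpace ℝ (Fin 3)),
      FunctionSpaces.HasWeakFDerivOn
        (⟨ball x₀ ρ, isOpen_ball⟩ : Opens (EuclideanSpace ℝ (Fin 3))) volume w Gw →
      (∫⁻ y in ball x₀ ρ, ‖w y‖ₑ ^ 2) ≠ ∞ →
      (∫⁻ y in ball x₀ ρ, ENNReal.ofReal (frobeniusNormSq (Gw y))) ≠ ∞ →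
      ∀ (ψ : EuclideanSpace ℝ (Fin 3) → ℝ), ContDiff ℝ 2 ψ → HasCompactSupport ψ →
      ∀ (r : ℝ), 0 < r →
        tsupport (newtonNearPotential (r / 2) r ψ) ⊆ ball x₀ ρ →
        ‖∫ y, fderiv ℝ (fderiv ℝ (newtonNearPotential (r / 2) r ψ)) y (w y) (w y)‖ₑ ≤
          K * (∫⁻ y in ball x₀ ρ, ‖w y‖ₑ ^ 2) ^ (1 / 2 : ℝ) *
            (∫⁻ y in ball x₀ ρ, ENNReal.ofReal (frobeniusNormSq (Gw y))) ^ (1 / 2 : ℝ) *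
            eLpNorm ψ 3 volume)
    {Ψ : ℝ × EuclideanSpace ℝ (Fin 3) → ℝ} (hΨ1 : ContDiff ℝ (⊤ : ℕ∞) Ψ)
    (hΨ2 : HasCompactSupport Ψ)
    (hΨ3 : tsupport Ψ ⊆ Ioo (z.1 - ρ ^ 2) (z.1 + ρ ^ 2) ×ˢ ball z.2 (3 / 4 * ρ)) :
    ‖∫ w in Ioo (z.1 - ρ ^ 2) (z.1 + ρ ^ 2) ×ˢ ball z.2 (3 / 4 * ρ), p w.1 w.2 * Ψ w‖ₑ ≤
      ∫⁻ s in Ioo (z.1 - ρ ^ 2) (z.1 + ρ ^ 2),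
        (ENNReal.ofReal (L₁ * (ρ / 4)⁻¹ ^ 3) * ∫⁻ y in ball z.2 ρ, ‖p s y‖ₑ) *
            (∫⁻ y, ‖Ψ (s, y)‖ₑ) +
          (K * (∫⁻ y in ball z.2 ρ, ‖u s y‖ₑ ^ 2) ^ (1 / 2 : ℝ) *
              (∫⁻ y in ball z.2 ρ, ENNReal.ofReal (frobeniusNormSq (G s y))) ^ (1 / 2 : ℝ)) *
            (∫⁻ y, ‖Ψ (s, y)‖ₑ ^ (3 : ℝ)) ^ (1 / (3 : ℝ)) := by
  -- ### geometry
  set a : ℝ := z.1 - ρ ^ 2 with ha_def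
  set b : ℝ := z.1 + ρ ^ 2 with hb_def
  set I : Set ℝ := Ioo a b with hI
  set B₃ : Set (EuclideanSpace ℝ (Fin 3)) := ball z.2 (3 / 4 * ρ) with hB₃
  set Bρ : Set (EuclideanSpace ℝ (Fin 3)) := ball z.2 ρ with hBρ
  set S : Set (ℝ × EuclideanSpace ℝ (Fin 3)) := I ×ˢ B₃ with hS
  set Q : Set (ℝ × EuclideanSpace ℝ (Fin 3)) := I ×ˢ Bρ with hQ
  have hQeq : parabolicCylinderCentered ρ z = Q := rfl
  have h34 : 3 / 4 * ρ + ρ / 4 = ρ := by ring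
  have h₀ : 0 < ρ / 4 / 2 := by positivity
  have h₁ : ρ / 4 / 2 < ρ / 4 := by linarith
  have hρ4 : 0 < ρ / 4 := by positivity
  have hSQ : S ⊆ Q := Set.prod_mono Subset.rfl (ball_subset_ball (by linarith))
  have hQΩ' : Q ⊆ (Ω : Set (ℝ × EuclideanSpace ℝ (Fin 3))) := hQeq ▸ hQΩ
  have hsub' : Ioo a b ×ˢ ball z.2 (3 / 4 * ρ + ρ / 4) ⊆
      (Ω : Set (ℝ × EuclideanSpace ℝ (Fin 3))) := by
    rw [h34]; exact hQΩ'
  -- ### the test function and the tested identity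
  set θ : ℝ → EuclideanSpace ℝ (Fin 3) → ℝ := fun t x => Ψ (t, x) with hθdef
  have hθ : IsSpaceTimeTestOn (⟨Ioo a b ×ˢ ball z.2 (3 / 4 * ρ), isOpen_Ioo.prod isOpen_ball⟩ :
      Opens (ℝ × EuclideanSpace ℝ (Fin 3))) θ := ⟨hΨ1, hΨ2, hΨ3⟩
  have hΨ0 : ∀ w, w ∉ S → Ψ w = 0 := fun w hw =>
    image_eq_zero_of_notMem_tsupport fun h => hw (hΨ3 h)
  have e1a : ∫ w in S, p w.1 w.2 * Ψ w = ∫ w, p w.1 w.2 * Ψ w :=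
    setIntegral_eq_integral_of_forall_compl_eq_zero fun w hw => by rw [hΨ0 w hw, mul_zero]
  have e1b : ∫ w in (Ω : Set (ℝ × EuclideanSpace ℝ (Fin 3))), p w.1 w.2 * θ w.1 w.2 =
      ∫ w, p w.1 w.2 * Ψ w :=
    setIntegral_eq_integral_of_forall_compl_eq_zero fun w hw => by
      change p w.1 w.2 * Ψ (w.1, w.2) = 0
      rw [hΨ0 w fun h => hw (hQΩ' (hSQ h)), mul_zero]
  have e1 := e1a.trans e1b.symm
  have e2 := hns.integral_pressure_mul_test_eq hfi hdivf hρ4 hsub' hθ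
  set Λθ : ℝ → EuclideanSpace ℝ (Fin 3) → ℝ := fun t =>
    newtonFarSmoothing (ρ / 4 / 2) (ρ / 4) (θ t) with hΛdef
  set Θ : ℝ → EuclideanSpace ℝ (Fin 3) → ℝ := fun t =>
    newtonNearPotential (ρ / 4 / 2) (ρ / 4) (θ t) with hΘdef
  -- ### supports of `Λθ` and `Θ`
  obtain ⟨hΛc, hΛsupp⟩ := tsupport_newtonFarSmoothing_slice_subset (ρ₀ := ρ / 4 / 2)
    (ρ₁ := ρ / 4) hθ h₀.le h₁
  rw [h34] at hΛsupp
  have hΛ0 : ∀ s y, (s, y) ∉ Q → Λθ s y = 0 := fun s y hsy =>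
    show uncurry Λθ (s, y) = 0 from image_eq_zero_of_notMem_tsupport fun h => hsy (hΛsupp h)
  have hΘ' := hθ.newtonNearPotential_slice h₀.le h₁
  have hΘsupp : tsupport (uncurry Θ) ⊆ Q := by
    have := hΘ'.tsupport_subset
    rwa [show ((⟨Ioo a b ×ˢ ball z.2 (3 / 4 * ρ + ρ / 4), isOpen_Ioo.prod isOpen_ball⟩ :
      Opens (ℝ × EuclideanSpace ℝ (Fin 3))) : Set (ℝ × EuclideanSpace ℝ (Fin 3))) =
      Ioo a b ×ˢ ball z.2 (3 / 4 * ρ + ρ / 4) from rfl, h34] at this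
  have hΘΩ : IsSpaceTimeTestOn Ω Θ := ⟨hΘ'.contDiff, hΘ'.hasCompactSupport, hΘsupp.trans hQΩ'⟩
  have hΘslice : ∀ s, tsupport (Θ s) ⊆ Bρ := fun s =>
    tsupport_slice_subset_of_tsupport_subset_prod hΘ'.hasCompactSupport hΘsupp s
  -- ### slice norms of `Ψ`
  set Θ₁ : ℝ → ℝ≥0∞ := fun s => ∫⁻ y, ‖Ψ (s, y)‖ₑ with hΘ₁
  set Θ₃ : ℝ → ℝ≥0∞ := fun s => (∫⁻ y, ‖Ψ (s, y)‖ₑ ^ (3 : ℝ)) ^ (1 / (3 : ℝ)) with hΘ₃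
  have hΘ₁fin : ∀ s, Θ₁ s < ∞ := fun s =>
    ((hθ.contDiff_slice s).continuous.integrable_of_hasCompactSupport
      (hθ.hasCompactSupport_slice s)).2
  have hΘ₃eq : ∀ s, eLpNorm (θ s) 3 volume = Θ₃ s := fun s => by
    rw [eLpNorm_eq_lintegral_rpow_enorm_toReal (by norm_num) (by norm_num), ENNReal.toReal_ofNat]
  -- ### slice quantities of `u`, `G`, `p`
  set av : ℝ → ℝ≥0∞ := fun s => ∫⁻ y in Bρ, ‖u s y‖ₑ ^ 2 with hav
  set ev : ℝ → ℝ≥0∞ := fun s => ∫⁻ y in Bρ, ENNReal.ofReal (frobeniusNormSq (G s y)) with hev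
  set π : ℝ → ℝ≥0∞ := fun s => ∫⁻ y in Bρ, ‖p s y‖ₑ with hπ
  set Lr : ℝ≥0 := (L₁ * (ρ / 4)⁻¹ ^ 3 : ℝ).toNNReal with hLr
  have hLr_coe : (Lr : ℝ≥0∞) = ENNReal.ofReal (L₁ * (ρ / 4)⁻¹ ^ 3) := rfl
  have hL : ∀ y, ‖newtonFarLaplacian (ρ / 4 / 2) (ρ / 4) y‖ ≤ Lr := fun y =>
    (hL₁ (ρ / 4) hρ4 y).trans (Real.le_coe_toNNReal _)
  -- ### Part A: the harmonic part
  have hA : ‖∫ w in (Ω : Set (ℝ × EuclideanSpace ℝ (Fin 3))), p w.1 w.2 * Λθ w.1 w.2‖ₑ ≤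
      ∫⁻ s in I, (Lr * π s) * Θ₁ s := by
    have hslice : ∀ s, ∫⁻ y, ‖p s y‖ₑ * ‖Λθ s y‖ₑ ≤ I.indicator (fun s => (Lr * π s) * Θ₁ s) s := by
      intro s
      by_cases hs : s ∈ I
      · rw [indicator_of_mem hs]
        have hsupp : support (fun y => ‖p s y‖ₑ * ‖Λθ s y‖ₑ) ⊆ Bρ := by
          intro y hy
          by_contra hyB
          refine hy ?_
          simp [hΛ0 s y fun h => hyB h.2]
        have hfin : (Lr : ℝ≥0∞) * Θ₁ s ≠ ∞ := ENNReal.mul_ne_top ENNReal.coe_ne_top (hΘ₁fin s).ne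
        calc ∫⁻ y, ‖p s y‖ₑ * ‖Λθ s y‖ₑ = ∫⁻ y in Bρ, ‖p s y‖ₑ * ‖Λθ s y‖ₑ :=
              (setLIntegral_eq_of_support_subset hsupp).symm
          _ ≤ ∫⁻ y in Bρ, ‖p s y‖ₑ * (Lr * Θ₁ s) := by
              refine lintegral_mono fun y => mul_le_mul_right ?_ _
              exact enorm_newtonFarSmoothing_half_le hL (θ s) y
          _ = π s * (Lr * Θ₁ s) := lintegral_mul_const' _ _ hfin
          _ = Lr * π s * Θ₁ s := by ring
      · rw [indicator_of_notMem hs]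
        refine le_of_eq ?_
        have h0 : (fun y => ‖p s y‖ₑ * ‖Λθ s y‖ₑ) = fun _ => 0 := funext fun y => by
          rw [hΛ0 s y fun h => hs h.1, enorm_zero, mul_zero]
        rw [h0, lintegral_zero]
    calc ‖∫ w in (Ω : Set (ℝ × EuclideanSpace ℝ (Fin 3))), p w.1 w.2 * Λθ w.1 w.2‖ₑ
        ≤ ∫⁻ w in (Ω : Set (ℝ × EuclideanSpace ℝ (Fin 3))), ‖p w.1 w.2 * Λθ w.1 w.2‖ₑ :=
          enorm_integral_le_lintegral_enorm _
      _ ≤ ∫⁻ w : ℝ × EuclideanSpace ℝ (Fin 3), ‖p w.1 w.2 * Λθ w.1 w.2‖ₑ :=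
          lintegral_mono' Measure.restrict_le_self le_rfl
      _ = ∫⁻ w : ℝ × EuclideanSpace ℝ (Fin 3), ‖p w.1 w.2‖ₑ * ‖Λθ w.1 w.2‖ₑ := by
          simp_rw [enorm_mul]
      _ ≤ ∫⁻ s, ∫⁻ y, ‖p s y‖ₑ * ‖Λθ s y‖ₑ := by
          rw [Measure.volume_eq_prod]; exact lintegral_prod_le _
      _ ≤ ∫⁻ s, I.indicator (fun s => (Lr * π s) * Θ₁ s) s := lintegral_mono hslice
      _ = ∫⁻ s in I, (Lr * π s) * Θ₁ s := lintegral_indicator measurableSet_Ioo _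
  -- ### Part B: the Calderón–Zygmund part
  set F : ℝ × EuclideanSpace ℝ (Fin 3) → ℝ := fun w =>
    fderiv ℝ (fderiv ℝ (Θ w.1)) w.2 (u w.1 w.2) (u w.1 w.2) with hF
  have hB : ‖∫ w in (Ω : Set (ℝ × EuclideanSpace ℝ (Fin 3))), F w‖ₑ ≤
      ∫⁻ s in I, (K * av s ^ (1 / 2 : ℝ) * ev s ^ (1 / 2 : ℝ)) * Θ₃ s := by
    obtain ⟨hu, hu2, -, -, -⟩ := hns
    -- coordinates, vanishing off the support, integrability
    set e := EuclideanSpace.basisFun (Fin 3) ℝ with he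
    set H : Fin 3 → Fin 3 → ℝ × EuclideanSpace ℝ (Fin 3) → ℝ := fun i j w =>
      fderiv ℝ (fun y => fderiv ℝ (Θ w.1) y (e i)) w.2 (e j) with hH
    have hHc : ∀ i j, Continuous (H i j) := fun i j => hΘΩ.continuous_fderiv_fderiv_slice _ _
    have hH0 : ∀ i j w, w ∉ tsupport (uncurry Θ) → H i j w = 0 := fun i j w hw =>
      fderiv_fderiv_slice_eq_zero_of_notMem_tsupport (ψ := Θ) (t := w.1) (x := w.2) hw _ _
    have hHess : ∀ w : ℝ × EuclideanSpace ℝ (Fin 3),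
        F w = ∑ i, ∑ j, (⟪u w.1 w.2, e i⟫ * ⟪u w.1 w.2, e j⟫) * H i j w := fun w =>
      fderiv_fderiv_apply_apply_eq_sum (contDiff_infty.1 (hΘΩ.contDiff_slice w.1) 2) _ _
    have hF0 : ∀ w, w ∉ tsupport (uncurry Θ) → F w = 0 := fun w hw => by
      rw [hHess w]
      simp only [hH0 _ _ w hw, mul_zero, Finset.sum_const_zero]
    have I3 : Integrable F ((volume : Measure (ℝ × EuclideanSpace ℝ (Fin 3))).restrict Ω) := by
      simp_rw [funext hHess]
      refine integrable_finsetSum _ fun i _ => integrable_finsetSum _ fun j _ => ?_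
      obtain ⟨C, hC⟩ := (hHc i j).bounded_above_of_compact_support
        (HasCompactSupport.intro hΘΩ.hasCompactSupport (hH0 i j))
      have hKi := hu2.integrableOn_compact_subset hΘΩ.tsupport_subset hΘΩ.hasCompactSupport
      have hmeas : AEStronglyMeasurable (fun w : ℝ × EuclideanSpace ℝ (Fin 3) =>
          (⟪u w.1 w.2, e i⟫ * ⟪u w.1 w.2, e j⟫) * H i j w)
          ((volume : Measure (ℝ × EuclideanSpace ℝ (Fin 3))).restrict Ω) := by
        have hum : AEStronglyMeasurable (uncurry u)
            ((volume : Measure (ℝ × EuclideanSpace ℝ (Fin 3))).restrict Ω) :=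
          hu.aestronglyMeasurable
        exact ((hum.inner aestronglyMeasurable_const).mul
          (hum.inner aestronglyMeasurable_const)).mul (hHc i j).aestronglyMeasurable
      refine Integrable.mono' (g := fun w => C * (tsupport (uncurry Θ)).indicator
        (fun w => ‖uncurry u w‖ ^ 2) w) ?_ hmeas (Eventually.of_forall fun w => ?_)
      · exact (((integrable_indicator_iff (isClosed_tsupport _).measurableSet).2 hKi).const_mul
          C).mono_measure Measure.restrict_le_self
      · by_cases hw : w ∈ tsupport (uncurry Θ)
        · rw [indicator_of_mem hw, norm_mul, norm_mul]
          have h1 : ‖⟪u w.1 w.2, e i⟫‖ ≤ ‖u w.1 w.2‖ := by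
            refine (norm_inner_le_norm _ _).trans ?_
            rw [e.orthonormal.1 i, mul_one]
          have h2 : ‖⟪u w.1 w.2, e j⟫‖ ≤ ‖u w.1 w.2‖ := by
            refine (norm_inner_le_norm _ _).trans ?_
            rw [e.orthonormal.1 j, mul_one]
          calc ‖⟪u w.1 w.2, e i⟫‖ * ‖⟪u w.1 w.2, e j⟫‖ * ‖H i j w‖
              ≤ ‖u w.1 w.2‖ * ‖u w.1 w.2‖ * C :=
                mul_le_mul (mul_le_mul h1 h2 (norm_nonneg _) (norm_nonneg _)) (hC w)
                  (norm_nonneg _) (mul_nonneg (norm_nonneg _) (norm_nonneg _))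
            _ = C * ‖uncurry u w‖ ^ 2 := by
                rw [show uncurry u w = u w.1 w.2 from rfl]; ring
        · rw [hH0 i j w hw, mul_zero, norm_zero, indicator_of_notMem hw, mul_zero]
    have hFint : Integrable F (volume : Measure (ℝ × EuclideanSpace ℝ (Fin 3))) := by
      have hsuppF : support F ⊆ (Ω : Set (ℝ × EuclideanSpace ℝ (Fin 3))) := fun w hw =>
        by_contra fun hwΩ => hw (hF0 w fun h => hwΩ (hΘΩ.tsupport_subset h))
      exact (integrableOn_iff_integrable_of_support_subset hsuppF).1 I3
    -- the good time slices
    have hprodQ : ((volume : Measure (ℝ × EuclideanSpace ℝ (Fin 3))).restrict Q) =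
        (volume.restrict I).prod (volume.restrict Bρ) := by
      rw [hQ, Measure.volume_eq_prod, Measure.prod_restrict]
    have hGm : AEStronglyMeasurable (uncurry G)
        ((volume : Measure (ℝ × EuclideanSpace ℝ (Fin 3))).restrict Q) :=
      hG.locallyIntegrableOn_grad.aestronglyMeasurable
    have hGm2 : AEMeasurable (fun w : ℝ × EuclideanSpace ℝ (Fin 3) =>
        ENNReal.ofReal (frobeniusNormSq (G w.1 w.2)))
        ((volume.restrict I).prod (volume.restrict Bρ)) := by
      rw [← hprodQ]
      exact (continuous_frobeniusNormSq'.comp_aestronglyMeasurable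
        hGm).aemeasurable.ennreal_ofReal
    have hem : AEMeasurable ev (volume.restrict I) := hGm2.lintegral_prod_right'
    have hVeq : gradV G ρ z = ∫⁻ s in I, ev s := by
      rw [gradV, hQeq, show ((volume : Measure (ℝ × EuclideanSpace ℝ (Fin 3))).restrict Q) =
        (volume.restrict I).prod (volume.restrict Bρ) from hprodQ, lintegral_prod _ hGm2]
    have h1ae : ∀ᵐ s ∂(volume.restrict I), av s ≤ energyU u ρ z := ENNReal.ae_le_essSup _
    have h2ae : ∀ᵐ s ∂(volume.restrict I), ev s < ∞ := by
      refine ae_lt_top' hem ?_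
      rw [← hVeq]; exact hV
    have h3ae : ∀ᵐ s ∂(volume.restrict I), FunctionSpaces.HasWeakFDerivOn
        (⟨ball z.2 ρ, isOpen_ball⟩ : Opens (EuclideanSpace ℝ (Fin 3))) volume (u s) (G s) :=
      hG.ae_hasWeakFDerivOn_slice (Ω := (⟨ball z.2 ρ, isOpen_ball⟩ :
        Opens (EuclideanSpace ℝ (Fin 3))))
    have hgood : ∀ᵐ s ∂(volume.restrict I),
        ‖∫ y, F (s, y)‖ₑ ≤ (K * av s ^ (1 / 2 : ℝ) * ev s ^ (1 / 2 : ℝ)) * Θ₃ s := by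
      filter_upwards [h1ae, h2ae, h3ae] with s h1 h2 h3
      have ha' : av s ≠ ∞ := ne_top_of_le_ne_top hU h1
      have key := hK z.2 ρ hρ (u s) (G s) h3 ha' h2.ne (θ s)
        (contDiff_infty.1 (hθ.contDiff_slice s) 2) (hθ.hasCompactSupport_slice s) (ρ / 4) hρ4
        (hΘslice s)
      rw [hΘ₃eq s] at key
      exact key
    have hae : ∀ᵐ s ∂(volume : Measure ℝ), ‖∫ y, F (s, y)‖ₑ ≤
        I.indicator (fun s => (K * av s ^ (1 / 2 : ℝ) * ev s ^ (1 / 2 : ℝ)) * Θ₃ s) s := by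
      have h' := (ae_restrict_iff' (measurableSet_Ioo : MeasurableSet I)).1 hgood
      filter_upwards [h'] with s hs
      by_cases hsI : s ∈ I
      · rw [indicator_of_mem hsI]; exact hs hsI
      · rw [indicator_of_notMem hsI]
        have h0 : (fun y => F (s, y)) = fun _ => 0 :=
          funext fun y => hF0 (s, y) fun h => hsI (hΘsupp h).1
        rw [h0, integral_zero, enorm_zero]
    have hFint' : Integrable F
        ((volume : Measure ℝ).prod (volume : Measure (EuclideanSpace ℝ (Fin 3)))) := by
      rw [← Measure.volume_eq_prod]; exact hFint
    calc ‖∫ w in (Ω : Set (ℝ × EuclideanSpace ℝ (Fin 3))), F w‖ₑ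
        = ‖∫ w : ℝ × EuclideanSpace ℝ (Fin 3), F w‖ₑ := by
          rw [setIntegral_eq_integral_of_forall_compl_eq_zero fun w hw =>
            hF0 w fun h => hw (hΘΩ.tsupport_subset h)]
      _ = ‖∫ s, ∫ y, F (s, y)‖ₑ := by
          rw [Measure.volume_eq_prod, integral_prod _ hFint']
      _ ≤ ∫⁻ s, ‖∫ y, F (s, y)‖ₑ := enorm_integral_le_lintegral_enorm _
      _ ≤ ∫⁻ s, I.indicator (fun s => (K * av s ^ (1 / 2 : ℝ) * ev s ^ (1 / 2 : ℝ)) * Θ₃ s) s :=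
          lintegral_mono_ae hae
      _ = ∫⁻ s in I, (K * av s ^ (1 / 2 : ℝ) * ev s ^ (1 / 2 : ℝ)) * Θ₃ s :=
          lintegral_indicator measurableSet_Ioo _
  -- ### assemble
  rw [e1, e2]
  refine (enorm_sub_le.trans (add_le_add hA hB)).trans ?_
  rw [hLr_coe]
  exact le_lintegral_add _ _

/-! ### The bilinear bound `∬ |p| |u|` -/

/-- **The local pressure against the velocity, before the Hölder bookkeeping of
(13.28)–(13.29)** (Lemarié-Rieusset 2016, §13.9 p. 469: the two displays
"`|p_{ρ,x}(s,y)| ≤ C ρ⁻³ ∫_{B(x,ρ)} |p(s,z)| dz`" and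
"`‖q_{ρ,x}‖_{L^{3/2}} ≤ C ‖u‖_{L⁶_tL²_x(Q_ρ)} ‖∇ ⊗ u‖_{L²_tL²_x(Q_ρ)}`", integrated against `|u|`).
In the setting of `enorm_setIntegral_pressure_mul_test_le`, if moreover
`p ∈ L¹(Q_ρ(t,x))`, then
`∬_{I×B(x,3ρ/4)} |p| |u| ≤ ∫_I (L₁(ρ/4)⁻³ π(s) ∫_{B(x,3ρ/4)} |u(s)|
  + K a(s)^{1/2} e(s)^{1/2} (∫_{B(x,3ρ/4)} |u(s)|³)^{1/3}) ds` (in `[0, ∞]`): the dual bound and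
the mixed-norm density lemma `FunctionSpaces.lintegral_enorm_mul_le_mixed_of_forall_test`
(the weights `π`, `a^{1/2}e^{1/2}` are integrable on `I` as `p ∈ L¹(Q_ρ)`, `U_ρ, V_ρ < ∞`).
[cite: LemarieRieusset2016, §13.9 (13.28)–(13.29) p. 469] -/
theorem lintegral_pressure_velocity_le_mixed
    (hns : IsDistributionalNSSolutionOn Ω ν f u p)
    (hfi : LocallyIntegrableOn (uncurry f) (Ω : Set (ℝ × EuclideanSpace ℝ (Fin 3))) volume)
    (hdivf : ∀ φ : ℝ → EuclideanSpace ℝ (Fin 3) → ℝ, IsSpaceTimeTestOn Ω φ →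
      ∫ t, ∫ x, ⟪f t x, gradient (φ t) x⟫ = 0)
    (hρ : 0 < ρ)
    (hQΩ : parabolicCylinderCentered ρ z ⊆ (Ω : Set (ℝ × EuclideanSpace ℝ (Fin 3))))
    (hG : HasWeakSpatialGradientOn (parabolicCylinderCenteredOpens ρ z) u G)
    (hU : energyU u ρ z ≠ ∞) (hV : gradV G ρ z ≠ ∞)
    (hpint : IntegrableOn (uncurry p) (parabolicCylinderCentered ρ z) volume)
    {L₁ : ℝ≥0} (hL₁ : ∀ r : ℝ, 0 < r → ∀ y : EuclideanSpace ℝ (Fin 3),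
      ‖newtonFarLaplacian (r / 2) r y‖ ≤ L₁ * r⁻¹ ^ 3)
    {K : ℝ≥0} (hK : ∀ (x₀ : EuclideanSpace ℝ (Fin 3)) (ρ : ℝ), 0 < ρ →
      ∀ (w : EuclideanSpace ℝ (Fin 3) → EuclideanSpace ℝ (Fin 3))
      (Gw : EuclideanSpace ℝ (Fin 3) → EuclideanSpace ℝ (Fin 3) →L[ℝ] EuclideanSpace ℝ (Fin 3)),
      FunctionSpaces.HasWeakFDerivOn
        (⟨ball x₀ ρ, isOpen_ball⟩ : Opens (EuclideanSpace ℝ (Fin 3))) volume w Gw →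
      (∫⁻ y in ball x₀ ρ, ‖w y‖ₑ ^ 2) ≠ ∞ →
      (∫⁻ y in ball x₀ ρ, ENNReal.ofReal (frobeniusNormSq (Gw y))) ≠ ∞ →
      ∀ (ψ : EuclideanSpace ℝ (Fin 3) → ℝ), ContDiff ℝ 2 ψ → HasCompactSupport ψ →
      ∀ (r : ℝ), 0 < r →
        tsupport (newtonNearPotential (r / 2) r ψ) ⊆ ball x₀ ρ →
        ‖∫ y, fderiv ℝ (fderiv ℝ (newtonNearPotential (r / 2) r ψ)) y (w y) (w y)‖ₑ ≤
          K * (∫⁻ y in ball x₀ ρ, ‖w y‖ₑ ^ 2) ^ (1 / 2 : ℝ) *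
            (∫⁻ y in ball x₀ ρ, ENNReal.ofReal (frobeniusNormSq (Gw y))) ^ (1 / 2 : ℝ) *
            eLpNorm ψ 3 volume) :
    ∫⁻ w in Ioo (z.1 - ρ ^ 2) (z.1 + ρ ^ 2) ×ˢ ball z.2 (3 / 4 * ρ), ‖p w.1 w.2‖ₑ * ‖u w.1 w.2‖ₑ ≤
      ∫⁻ s in Ioo (z.1 - ρ ^ 2) (z.1 + ρ ^ 2),
        (ENNReal.ofReal (L₁ * (ρ / 4)⁻¹ ^ 3) * ∫⁻ y in ball z.2 ρ, ‖p s y‖ₑ) *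
            (∫⁻ y in ball z.2 (3 / 4 * ρ), ‖u s y‖ₑ) +
          (K * (∫⁻ y in ball z.2 ρ, ‖u s y‖ₑ ^ 2) ^ (1 / 2 : ℝ) *
              (∫⁻ y in ball z.2 ρ, ENNReal.ofReal (frobeniusNormSq (G s y))) ^ (1 / 2 : ℝ)) *
            (∫⁻ y in ball z.2 (3 / 4 * ρ), ‖u s y‖ₑ ^ (3 : ℝ)) ^ (1 / (3 : ℝ)) := by
  -- ### geometry and measures
  set a : ℝ := z.1 - ρ ^ 2 with ha_def
  set b : ℝ := z.1 + ρ ^ 2 with hb_def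
  set I : Set ℝ := Ioo a b with hI
  set B₃ : Set (EuclideanSpace ℝ (Fin 3)) := ball z.2 (3 / 4 * ρ) with hB₃
  set Bρ : Set (EuclideanSpace ℝ (Fin 3)) := ball z.2 ρ with hBρ
  set S : Set (ℝ × EuclideanSpace ℝ (Fin 3)) := I ×ˢ B₃ with hS
  set Q : Set (ℝ × EuclideanSpace ℝ (Fin 3)) := I ×ˢ Bρ with hQ
  have hQeq : parabolicCylinderCentered ρ z = Q := rfl
  have hSQ : S ⊆ Q := Set.prod_mono Subset.rfl (ball_subset_ball (by linarith))
  have hprodQ : ((volume : Measure (ℝ × EuclideanSpace ℝ (Fin 3))).restrict Q) =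
      (volume.restrict I).prod (volume.restrict Bρ) := by
    rw [hQ, Measure.volume_eq_prod, Measure.prod_restrict]
  have hIfin : volume I ≠ ∞ := measure_Ioo_lt_top.ne
  -- ### the slice quantities and their measurability
  set av : ℝ → ℝ≥0∞ := fun s => ∫⁻ y in Bρ, ‖u s y‖ₑ ^ 2 with hav
  set ev : ℝ → ℝ≥0∞ := fun s => ∫⁻ y in Bρ, ENNReal.ofReal (frobeniusNormSq (G s y)) with hev
  set π : ℝ → ℝ≥0∞ := fun s => ∫⁻ y in Bρ, ‖p s y‖ₑ with hπ
  have hum : AEStronglyMeasurable (uncurry u)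
      ((volume : Measure (ℝ × EuclideanSpace ℝ (Fin 3))).restrict Q) :=
    hG.locallyIntegrableOn.aestronglyMeasurable
  have hGm : AEStronglyMeasurable (uncurry G)
      ((volume : Measure (ℝ × EuclideanSpace ℝ (Fin 3))).restrict Q) :=
    hG.locallyIntegrableOn_grad.aestronglyMeasurable
  have hpm : AEStronglyMeasurable (uncurry p)
      ((volume : Measure (ℝ × EuclideanSpace ℝ (Fin 3))).restrict Q) := hpint.1
  have hum2 : AEMeasurable (fun w : ℝ × EuclideanSpace ℝ (Fin 3) => ‖u w.1 w.2‖ₑ ^ 2)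
      ((volume.restrict I).prod (volume.restrict Bρ)) := by
    rw [← hprodQ]; exact hum.enorm.pow_const 2
  have hGm2 : AEMeasurable (fun w : ℝ × EuclideanSpace ℝ (Fin 3) =>
      ENNReal.ofReal (frobeniusNormSq (G w.1 w.2)))
      ((volume.restrict I).prod (volume.restrict Bρ)) := by
    rw [← hprodQ]
    exact (continuous_frobeniusNormSq'.comp_aestronglyMeasurable
      hGm).aemeasurable.ennreal_ofReal
  have hpm1 : AEMeasurable (fun w : ℝ × EuclideanSpace ℝ (Fin 3) => ‖p w.1 w.2‖ₑ)
      ((volume.restrict I).prod (volume.restrict Bρ)) := by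
    rw [← hprodQ]; exact hpm.enorm
  have ham : AEMeasurable av (volume.restrict I) := hum2.lintegral_prod_right'
  have hem : AEMeasurable ev (volume.restrict I) := hGm2.lintegral_prod_right'
  have hπm : AEMeasurable π (volume.restrict I) := hpm1.lintegral_prod_right'
  -- ### finiteness of the weights on `I`
  have hπI : ∫⁻ s in I, π s ≠ ∞ := by
    have h1 : ∫⁻ w in Q, ‖p w.1 w.2‖ₑ = ∫⁻ s in I, π s := by
      rw [show ((volume : Measure (ℝ × EuclideanSpace ℝ (Fin 3))).restrict Q) =
        (volume.restrict I).prod (volume.restrict Bρ) from hprodQ, lintegral_prod _ hpm1]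
    rw [← h1]
    exact hpint.2.ne
  have hVeq : gradV G ρ z = ∫⁻ s in I, ev s := by
    rw [gradV, hQeq, show ((volume : Measure (ℝ × EuclideanSpace ℝ (Fin 3))).restrict Q) =
      (volume.restrict I).prod (volume.restrict Bρ) from hprodQ, lintegral_prod _ hGm2]
  have h1ae : ∀ᵐ s ∂(volume.restrict I), av s ≤ energyU u ρ z := ENNReal.ae_le_essSup _
  have hαI : ∫⁻ s in I, ENNReal.ofReal (L₁ * (ρ / 4)⁻¹ ^ 3) * π s ≠ ∞ := by
    rw [lintegral_const_mul'' _ hπm]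
    exact ENNReal.mul_ne_top ENNReal.ofReal_ne_top hπI
  have hβI : ∫⁻ s in I, K * av s ^ (1 / 2 : ℝ) * ev s ^ (1 / 2 : ℝ) ≠ ∞ := by
    have hle : ∫⁻ s in I, K * av s ^ (1 / 2 : ℝ) * ev s ^ (1 / 2 : ℝ) ≤
        K * energyU u ρ z ^ (1 / 2 : ℝ) * ((∫⁻ s in I, ev s ^ (1 : ℝ)) ^ ((1 / 2 : ℝ) / 1) *
          volume I ^ (1 - (1 / 2 : ℝ) / 1)) := by
      calc ∫⁻ s in I, K * av s ^ (1 / 2 : ℝ) * ev s ^ (1 / 2 : ℝ)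
          ≤ ∫⁻ s in I, K * energyU u ρ z ^ (1 / 2 : ℝ) * ev s ^ (1 / 2 : ℝ) := by
            refine lintegral_mono_ae (h1ae.mono fun s hs => ?_)
            gcongr
        _ = K * energyU u ρ z ^ (1 / 2 : ℝ) * ∫⁻ s in I, ev s ^ (1 / 2 : ℝ) :=
            lintegral_const_mul'' _ (hem.pow_const _)
        _ ≤ K * energyU u ρ z ^ (1 / 2 : ℝ) * ((∫⁻ s in I, ev s ^ (1 : ℝ)) ^ ((1 / 2 : ℝ) / 1) *
              volume I ^ (1 - (1 / 2 : ℝ) / 1)) := by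
            gcongr
            exact setLIntegral_rpow_le_rpow_mul_measure volume I hem (by norm_num) (by norm_num)
    refine ne_top_of_le_ne_top ?_ hle
    have hV1 : (∫⁻ s in I, ev s ^ (1 : ℝ)) ≠ ∞ := by
      simp_rw [ENNReal.rpow_one]; rw [← hVeq]; exact hV
    exact ENNReal.mul_ne_top (ENNReal.mul_ne_top ENNReal.coe_ne_top
      (ENNReal.rpow_ne_top_of_nonneg (by norm_num) hU))
      (ENNReal.mul_ne_top (ENNReal.rpow_ne_top_of_nonneg (by norm_num) hV1)
        (ENNReal.rpow_ne_top_of_nonneg (by norm_num) hIfin))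
  -- ### the density lemma
  have hE : IntegrableOn (fun w : ℝ × EuclideanSpace ℝ (Fin 3) => p w.1 w.2) S volume :=
    hpint.mono_set hSQ
  have hg : AEMeasurable (fun w : ℝ × EuclideanSpace ℝ (Fin 3) => ‖u w.1 w.2‖ₑ)
      (volume.restrict S) :=
    (hum.mono_measure (Measure.restrict_mono hSQ le_rfl)).enorm
  have key := FunctionSpaces.lintegral_enorm_mul_le_mixed_of_forall_test
    (X := EuclideanSpace ℝ (Fin 3)) (I := I) (B := B₃) isOpen_Ioo isOpen_ball
    measure_ball_lt_top.ne hE (α := fun s => ENNReal.ofReal (L₁ * (ρ / 4)⁻¹ ^ 3) * π s)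
    (β := fun s => K * av s ^ (1 / 2 : ℝ) * ev s ^ (1 / 2 : ℝ)) (hπm.const_mul _)
    (((ham.pow_const _).const_mul _).mul (hem.pow_const _)) hαI hβI (r := 3) (by norm_num)
    (fun Ψ hΨ1 hΨ2 hΨ3 => enorm_setIntegral_pressure_mul_test_le hns hfi hdivf hρ hQΩ hG hU hV
      hL₁ hK hΨ1 hΨ2 hΨ3) hg
  exact key

end Literature.Analysis.FluidPDE
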